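import Summits.BirchSwinnertonDyer.BirchSwinnertonDyer.Theorems.EdixhovenFibreFiveSevenStarredOptimalManinUnitFiveSevenRecTowerCellsOfLocalFormulaAlt
import Summits.BirchSwinnertonDyer.BirchSwinnertonDyer.Theorems.EdixhovenFibreFiveSevenRecTowerAtCyclotomicOverCompletionOfIsDeRham
import Summits.BirchSwinnertonDyer.BirchSwinnertonDyer.Theorems.EdixhovenFibreFiveSevenLocalFormulaOrdinaryAnyPrime
import Summits.BirchSwinnertonDyer.BirchSwinnertonDyer.Theorems.EdixhovenFibreFiveSevenStarredOptimalManinUnitFiveSevenOrdinaryCellsDeRham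
import HarnessLib

/-!
# [REC-tower] PROVED at every cyclotomic tower `ℚ_v ⊆ ℚ(ζ_m)_w` for the (G)-ORDINARY UNSTARRED potentially good curves at EVERY prime `p ≥ 5` (so `p ≥ 11`)
# (route `EdixhovenFibreFiveSeven`, line `kato-lever`, crux TDS11 stmt-BirchSwinnertonDyer-22228; seat `bsd-line-edix-p1` g33, LEAD)

HONEST FRAMING. Four theorems (no definition, no named fact, no instance, no `sorry`; file-local instance keys on `ℚ_v` byte-identical to
`…RecTowerCellsOfLocalFormulaAlt` l.56–61); helper `--supports` crux TDS11 `TwistDegreeStepOrdinary` (stmt-BirchSwinnertonDyer-22228, the `p ≥ 11` (G)-ordinary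
residue of the rung W-ALL/2.p≥5.r1), whose conditional closer of record `…TwistDegreeStepOrdinaryOfReciprocityLaw.twistDegreeStepOrdinary_of_reciprocityLaw_of_sl2NeronValuesBar`
takes Kato's explicit reciprocity law [REC-tower] (`tatePairingPoint_eq_trace_expStar_log_tower`, cite-only) as a hypothesis. Nothing is closed; BSD / TDS11 are NOT
proved by this.

WHAT. Kato's explicit reciprocity law [REC-tower] in the INTRINSIC, ALTERNATING-TOWER shape of the K★ stubs (`∃ c ≠ 0`, lower clause at `ℚ_v`, upper clause at
`ℚ(ζ_m)_w`), for every globally minimal `W′/ℚ` at ANY prime `p ≥ 5` with additive reduction at `p`, `ord_p Δ_min ≤ 4` (Kodaira II, III, IV) and (G)-ORDINARY (`TypeGOrd W′ p`), at every cyclotomic tower `ℚ_v ⊆ ℚ(ζ_m)_w`, `p ∤ m` — a THEOREM: the width seat's generic turnkey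
`RecTowerAtCyclotomicOverCompletionOfIsDeRham.recTowerAt_cyclotomic_of_formula_over_completion` (ONE de Rham input at `ℚ_v`) with
`hDRv := isDeRham_place_of_typeGOrd` ((G)-ordinary ⟹ de Rham, tree `isDeRham_restrictedRationalTateRep_adicCompletion_rat_of_typeGOrd`, read in the place keys),
fed with Kato's LOCAL FORMULA over `K_{w′}`, `K = ℚ(ζ_m, p^{1/e})` (`StarredOptimalManinUnitFiveSevenRecTowerKData.exists_numberField_over_cyclotomic_pow_eq_prime`),
PROVED at these curves by `LocalFormulaOrdinaryAnyPrime.localFormulaOrdinaryUnstarred_of_typeGOrd` (this seat: the ordinary road of the K★ line re-keyed from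
`p ∈ {5, 7}` to the ordinary pattern + DEURING's congruence, which (G)-ordinarity supplies via `e ∣ p − 1`); the Prop-1.2.3 binders over `K_{w′}` directly from
`isDeRham_restrictedRationalTateRep_adicCompletion_of_typeGOrd` at `w′` and `cupLogInjective_and_hasDualExp_of_isDeRham_holds`.

* ★★★ `localFormulaOrdinaryStarred_of_typeGOrd` (the starred companion of `LocalFormulaOrdinaryAnyPrime` §3), ★ `isDeRham_place_of_typeGOrd`,
  ★★★ `recTowerOrdinaryUnstarred_of_typeGOrd`, ★★★ `recTowerOrdinaryStarred_of_typeGOrd` (`ord_p Δ_min ∈ {8, 9, 10}`; the `I₀*` row `ord = 6`, `e = 2`, whose good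
  model has a NON-CM ordinary fibre, is NOT covered by this method).

With the `p ∈ {5, 7}` cells (K★ stubs; `…RecTowerCellsOfLocalFormulaAlt`; `RecTowerUnstarredSupersingularCells`, this seat; the width seat's ordinary unstarred
cells) this makes [REC-tower] a tree theorem on the whole additive potentially good (G)-ordinary-or-`p ≤ 7` locus the Manin side of the rung uses; the TDS11 re-key
through `katoNeronBody_of_sl2NeronValuesBar_of_rangeAt` is the next file.

References: [Kato1993LNM1553] Ch. II §1.2.4, Prop. 1.2.3, Ex. 1.3.5, Thm. 1.4.1 (3)–(4); [BrinonConrad2009] Prop. 6.3.8; [CasselsFrohlichANT1967] Ch. II §10 (10.2);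
[Fontaine1982FormesDifferentielles] §5; [Serre1972] §5.6, §1.11; [SilvermanATAEC1994] IV Table 4.1.
-/

set_option autoImplicit false
-- the Theorems namespace of a single-conjunct summit repeats the summit name by design (D-0017)
set_option linter.dupNamespace false

noncomputable section

open scoped Classical NNReal TensorProduct NumberField
open CategoryTheory Function Field ValuativeRel IsDedekindDomain NumberField
open Literature.NumberTheory.GaloisRepresentations
open Literature.NumberTheory.GaloisRepresentations.IsNonarchimedeanLocalField
open Literature.NumberTheory.GaloisRepresentations.PeriodRingData
open Literature.NumberTheory.PAdicHodge
open Literature.NumberTheory.EllipticCurves _root_.WeierstrassCurve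
open Literature.NumberTheory.EllipticCurves.FormalGroupChart (padicLogPointFiniteExt)
open Summit.BirchSwinnertonDyer.BirchSwinnertonDyer.Theorems.StarredOptimalManinUnitFiveSevenRecTowerAtCyclotomicOverExt
open Summit.BirchSwinnertonDyer.BirchSwinnertonDyer.Theorems.RecTowerAtCyclotomicOverCompletionOfIsDeRham
open Summit.BirchSwinnertonDyer.BirchSwinnertonDyer.Theorems.StarredOptimalManinUnitFiveSevenRecTowerCellsOfLocalFormula (compatible_normValuation_adicCompletion)
open Summit.BirchSwinnertonDyer.BirchSwinnertonDyer.Theorems.LocalFormulaOrdinaryAnyPrime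
open Summit.BirchSwinnertonDyer.BirchSwinnertonDyer.Theorems.KimAtThreeDeepLowerExpStarOmega
open Summit.BirchSwinnertonDyer.BirchSwinnertonDyer.Theorems.KimAtThreeDeepLowerExpStarOmegaPlace
open Summit.BirchSwinnertonDyer.BirchSwinnertonDyer.Theorems.KimAtThreeDeepUpperTowerLattice (fact_natCast_mem_primesEquiv_symm)
open Summit.BirchSwinnertonDyer.Rank1Residual.GaloisImage
open Rat.HeightOneSpectrum Literature.NumberTheory.DiophantineGeometry
open Summit.BirchSwinnertonDyer.Rank1Residual Summit.BirchSwinnertonDyer.Rank1Residual.Additive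
  Literature.NumberTheory.EllipticCurves.Rank1Residual
open Literature.NumberTheory.AdelicBaseChange
open Summit.BirchSwinnertonDyer.BirchSwinnertonDyer.Theorems

namespace Summit.BirchSwinnertonDyer.BirchSwinnertonDyer.Theorems.RecTowerOrdinaryUnstarredAnyPrime

-- FILE-LOCAL instance keys, byte-identical to the accepted `…RecTowerCellsOfLocalFormulaAlt.lean` l.56–61 (no library instance is
-- overridden outside this file): the `Fact (p ∈ v_p)` key and the local-field structures on `ℚ_v = Place.Completion (inr v_p)`.
attribute [local instance] fact_natCast_mem_primesEquiv_symm
attribute [local instance 100000] NumberField.Place.instAlgebraCompletion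
attribute [local instance] valuativeRelPlace topologicalSpacePlace
attribute [local instance] isNonarchimedeanLocalField_place charZero_place
attribute [local instance] padicAlgebraPlace fact_not_isUnit_place isAdicComplete_place

set_option maxHeartbeats 1600000 in
/-- ★★★ **Kato's explicit reciprocity FORMULA at the (G)-ORDINARY STARRED potentially good cells, EVERY prime `p ≥ 5`** — the companion of
`LocalFormulaOrdinaryAnyPrime.localFormulaOrdinaryUnstarred_of_typeGOrd` on the cell table `ord = 8 ↦ e = 3`, `ord = 9 ↦ e = 4`, `ord = 10 ↦ e = 6` (Kodaira IV*, III*, II*;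
numerology `(3; 2,3,4; 1,0; 1,0)`, `(4; 3,3,5; 0,2; 0,1)`, `(6; 5,4,5; 4,0; 2,0)` — the K★ ordinary cells' numerology, now at any `p ≥ 5` with `TypeGOrd`):
for every globally minimal `W′/ℚ`, `p ≥ 5`, additive at `p`, `TypeGOrd W′ p`, the direct representation over the completion `K_{v′}` of any number field `K ∋ α`,
`α^e = p`, at any `v′ ∋ p` satisfies `∀ d″ ∃ c′`, `⟨[η″], P′⟩ = Tr_{K_{v′}/ℚ_p}(c′ · exp*_{d″}(η″) · log_{ω′} P′)`. Deuring's congruence from `e ∣ p − 1`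
(`TameExponent.semistabilityIndex_dvd_sub_one`). [cite: Kato1993LNM1553, Ch. II Thm. 1.4.1 (3)–(4), Lemma 1.4.3–1.4.5 and §1.2.4] [cite: Serre1972, §5.6 and §1.11]
[cite: SilvermanATAEC1994, IV Table 4.1] -/
theorem localFormulaOrdinaryStarred_of_typeGOrd :
    ∀ (W' : WeierstrassCurve ℚ) [W'.IsElliptic] [W'.IsGloballyMinimal] (p : ℕ) [Fact p.Prime], 5 ≤ p → Addv W' p → TypeGOrd W' p →
      ∀ {K : Type} [Field K] [NumberField K] (α : K) (e : ℕ),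
      (padicValInt p W'.minimalDiscriminantInt = 8 ∧ e = 3 ∨ padicValInt p W'.minimalDiscriminantInt = 9 ∧ e = 4 ∨
        padicValInt p W'.minimalDiscriminantInt = 10 ∧ e = 6) → α ^ e = (p : K) →
      ∀ (v' : HeightOneSpectrum (𝓞 K)) (hv' : ((p : ℕ) : 𝓞 K) ∈ v'.asIdeal)
      [CharZero (v'.adicCompletion K)] [Fact (¬ IsUnit ((p : ℕ) : integerC (v'.adicCompletion K)))]
      [IsAdicComplete (Ideal.span {((p : ℕ) : integerC (v'.adicCompletion K))}) (integerC (v'.adicCompletion K))]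
      (hp' : valuation (v'.adicCompletion K) ((p : ℕ) : (v'.adicCompletion K)) < 1)
      (ω' : Valuation (v'.adicCompletion K) ℝ≥0) [ω'.Compatible] [(W'.baseChange (v'.adicCompletion K)).IsIntegral ω'.integer],
      letI := LocalField.adicCompletionPadicAlgebra v' p hv'
      ∀ (e : (k : ℕ) → geomTorsion W' ((p ^ k : ℕ) : ℤ) → geomTorsion W' ((p ^ k : ℕ) : ℤ) → AlgebraicClosure ℚ) (hμ : ∀ k S T, e k S T ^ (p ^ k) = 1)
      (hadd₁ : ∀ k S₁ S₂ T, e k (S₁ + S₂) T = e k S₁ T * e k S₂ T) (hadd₂ : ∀ k S T₁ T₂, e k S (T₁ + T₂) = e k S T₁ * e k S T₂)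
      (hgal : ∀ k (σ : absoluteGaloisGroup ℚ) (S T : geomTorsion W' ((p ^ k : ℕ) : ℤ)), σ • e k S T = e k (σ • S) (σ • T))
      (_hnondeg : ∀ k (T : geomTorsion W' ((p ^ k : ℕ) : ℤ)), (∀ S, e k S T = 1) → T = 0) (_halt : ∀ k (S : geomTorsion W' ((p ^ k : ℕ) : ℤ)), e k S S = 1)
      (hcompat : ∀ k (S T : geomTorsion W' ((p ^ (k + 1) : ℕ) : ℤ)),
      e k (torsionMulHom W' (p ^ (k + 1)) (p ^ k) p (pow_succ p k).symm S) (torsionMulHom W' (p ^ (k + 1)) (p ^ k) p (pow_succ p k).symm T) = e (k + 1) S T ^ p),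
      (bdRPeriodRingData (F := (v'.adicCompletion K)) (p := p) hp').CupLogInjective (logCyclotomic p) (restrictedRationalTateRep W' (v'.adicCompletion K) p) →
      (∀ z : contOneCocycles (restrictedRationalTateRep W' (v'.adicCompletion K) p).toTopRep,
        (bdRPeriodRingData (F := (v'.adicCompletion K)) (p := p) hp').HasDualExp (logCyclotomic p) (restrictedRationalTateRep W' (v'.adicCompletion K) p) fun σ => z.1 σ) →
      ∀ d'' : (bdRPeriodRingData (F := (v'.adicCompletion K)) (p := p) hp').FilZeroLine (restrictedRationalTateRep W' (v'.adicCompletion K) p), ∃ c' : (v'.adicCompletion K),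
      ∀ (η'' : contOneCocycles (restrictedTateRep W' (v'.adicCompletion K) p).toTopRep) (P' : (W'.baseChange (v'.adicCompletion K)).toAffine.Point),
      ((tatePairingPoint W' (v'.adicCompletion K) p e hμ hadd₁ hadd₂ hgal hcompat (oneCocycleClass _ η'') P' : ℤ_[p]) : ℚ_[p]) =
        Algebra.trace ℚ_[p] (v'.adicCompletion K) (c' * expStarCoord W' hp' d'' η'' * padicLogPointFiniteExt ω' (W'.baseChange (v'.adicCompletion K)) p P') := by
  intro W' _ _ p _ hp5 hadd hG K _ _ α e htab hαe v' hv' _ _ _ hp' ω' _ _ eT hμ hadd₁ hadd₂ hgal hnondeg halt hcompat hinjK hdeK d''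
  have hj : 0 ≤ padicValRat p W'.j := padicValRat_j_nonneg_of_typeGOrd W' p hG
  have hdvd := TeichmullerTwistDescent.TameExponent.semistabilityIndex_dvd_sub_one W' p hp5 hG
  unfold semistabilityIndex at hdvd
  rcases htab with ⟨h8, rfl⟩ | ⟨h9, rfl⟩ | ⟨h10, rfl⟩
  · -- `ord = 8` (IV*), `e = 3`, `j̃ = 0`: numerology `(3; 2,3,4; 1,0; 1,0)`, `p ≡ 1 (mod 3)`
    rw [h8] at hdvd
    have hp3 : p % 3 = 1 := by
      have h3' : (12 / Nat.gcd 12 8 : ℕ) = 3 := by decide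
      rw [h3'] at hdvd; omega
    exact localFormula_of_ordinary_numerology_anyPrime W' p hp5 hj (e := 3) (k := 2) (m := 3) (n := 4) (r₄ := 1) (r₆ := 0) (t₄ := 1) (t₆ := 0)
      (by norm_num) (by norm_num) (by norm_num) (by norm_num) (by norm_num) (by rw [h8]) (by rw [h8]) (by norm_num) (by norm_num)
      (Or.inr ⟨rfl, rfl, by norm_num, hp3⟩) hαe v' hv' hp' ω' eT hμ hadd₁ hadd₂ hgal hnondeg halt hcompat hinjK hdeK d''
  · -- `ord = 9` (III*), `e = 4`, `j̃ = 1728`: numerology `(4; 3,3,5; 0,2; 0,1)`, `p ≡ 1 (mod 4)`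
    rw [h9] at hdvd
    have hp4 : p % 4 = 1 := by
      have h4' : (12 / Nat.gcd 12 9 : ℕ) = 4 := by decide
      rw [h4'] at hdvd; omega
    exact localFormula_of_ordinary_numerology_anyPrime W' p hp5 hj (e := 4) (k := 3) (m := 3) (n := 5) (r₄ := 0) (r₆ := 2) (t₄ := 0) (t₆ := 1)
      (by norm_num) (by norm_num) (by norm_num) (by norm_num) (by norm_num) (by rw [h9]) (by rw [h9]) (by norm_num) (by norm_num)
      (Or.inl ⟨rfl, rfl, by norm_num, hp4⟩) hαe v' hv' hp' ω' eT hμ hadd₁ hadd₂ hgal hnondeg halt hcompat hinjK hdeK d''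
  · -- `ord = 10` (II*), `e = 6`, `j̃ = 0`: numerology `(6; 5,4,5; 4,0; 2,0)`, `p ≡ 1 (mod 3)`
    rw [h10] at hdvd
    have hp3 : p % 3 = 1 := by
      have h6' : (12 / Nat.gcd 12 10 : ℕ) = 6 := by decide
      rw [h6'] at hdvd; omega
    exact localFormula_of_ordinary_numerology_anyPrime W' p hp5 hj (e := 6) (k := 5) (m := 4) (n := 5) (r₄ := 4) (r₆ := 0) (t₄ := 2) (t₆ := 0)
      (by norm_num) (by norm_num) (by norm_num) (by norm_num) (by norm_num) (by rw [h10]) (by rw [h10]) (by norm_num) (by norm_num)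
      (Or.inr ⟨rfl, rfl, by norm_num, hp3⟩) hαe v' hv' hp' ω' eT hμ hadd₁ hadd₂ hgal hnondeg halt hcompat hinjK hdeK d''

variable (W : WeierstrassCurve ℚ) [W.IsElliptic] (p : ℕ) [hp : Fact p.Prime] in
/-- ★ **`hDRv` HOLDS for a (G)-ORDINARY `W/ℚ` at any prime `p`**, in the place keys of `ℚ_v`: `V_pW|_{Γ_{ℚ_v}}` is de Rham —
`isDeRham_restrictedRationalTateRep_adicCompletion_rat_of_typeGOrd` read for `Place.instAlgebraCompletion` (any two `ℚ`-algebra structures on `ℚ_v` coincide),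
exactly as `isDeRham_place_of_potGoodFiveSeven`. [cite: Kato1993LNM1553, Ch. II Prop. 1.2.3 and Ex. 1.3.5] [cite: BrinonConrad2009, Prop. 6.3.8] -/
theorem isDeRham_place_of_typeGOrd (hG : TypeGOrd W p) :
    GaloisRep.IsDeRham (bdRPeriodRingData (valuation_place_lt_one p ((primesEquiv (R := 𝓞 ℚ)).symm ⟨p, hp.out⟩)))
      (localRationalTateRep W p (galRestrictPlace ((primesEquiv (R := 𝓞 ℚ)).symm ⟨p, hp.out⟩))) := by
  have hrep : ∀ (i₁ i₂ : Algebra ℚ ((((primesEquiv (R := 𝓞 ℚ)).symm ⟨p, hp.out⟩)).adicCompletion ℚ)),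
      @restrictedRationalTateRep ℚ _ W _ _ i₁ p _ _ = @restrictedRationalTateRep ℚ _ W _ _ i₂ p _ _ :=
    fun i₁ i₂ ↦ by rw [Subsingleton.elim i₁ i₂]
  have h0 := @isDeRham_restrictedRationalTateRep_adicCompletion_rat_of_typeGOrd W _ p _ hG
    ((primesEquiv (R := 𝓞 ℚ)).symm ⟨p, hp.out⟩) (fact_natCast_mem_primesEquiv_symm p).out (charZero_place _)
    (@fact_not_isUnit_place p _ (fact_natCast_mem_primesEquiv_symm p)) (@isAdicComplete_place p _ _ (fact_natCast_mem_primesEquiv_symm p))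
    (@valuation_place_lt_one p _ (fact_natCast_mem_primesEquiv_symm p)) (@padicAlgebraPlace p _ _ (fact_natCast_mem_primesEquiv_symm p))
  have h1 := (hrep (@DivisionRing.toRatAlgebra _ _ (charZero_place _)) (Place.instAlgebraCompletion (Sum.inr ((primesEquiv (R := 𝓞 ℚ)).symm ⟨p, hp.out⟩) : Place ℚ))) ▸ h0
  exact h1

/-- ★★★ **[REC-tower] at every cyclotomic tower for the (G)-ORDINARY unstarred potentially good curves, EVERY prime `p ≥ 5` — PROVED.** For every globally
minimal `W′/ℚ` with `p ≥ 5`, additive reduction at `p`, `ord_p Δ_min ≤ 4`, `TypeGOrd W′ p` (no `Irr` / no-`Iₙ*` binder needed), every `m` with `p ∤ m`, every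
place `w ∣ p` of `ℚ(ζ_m)` (keys quantified), every pair of compatible valuations, every ALTERNATING Weil tower, line data `d₀` at `ℚ_v` and `d` at `ℚ(ζ_m)_w` with the
compatibility `hcomp`, and the Prop-1.2.3 binders: **`∃ c ≠ 0` with `⟨[η₀], P⟩ = Tr(c·exp*_{d₀}(η₀)·log P)` at `ℚ_v` and `⟨[η], P⟩ = Tr(c·exp*_d(η)·log P)` at `ℚ(ζ_m)_w`.**
Proof: the generic turnkey `recTowerAt_cyclotomic_of_formula_over_completion` (`hDRv := isDeRham_place_of_typeGOrd`) over `K = ℚ(ζ_m, p^{1/e})` at a place `w′ ∣ w`, fed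
with Kato's local formula `localFormulaOrdinaryUnstarred_of_typeGOrd` (`e = 12/gcd(12, ord_p Δ_min)`, `TameExponent.padicValInt_mem`).
[cite: Kato1993LNM1553, Ch. II §1.2.4, Prop. 1.2.3 and Thm. 1.4.1 (3)–(4)] [cite: BrinonConrad2009, Prop. 6.3.8] [cite: Serre1972, §5.6]
[cite: SilvermanATAEC1994, IV Table 4.1] -/
theorem recTowerOrdinaryUnstarred_of_typeGOrd :
    ∀ (W' : WeierstrassCurve ℚ) [W'.IsElliptic] [W'.IsGloballyMinimal] (p : ℕ) [hp : Fact p.Prime], 5 ≤ p → Addv W' p →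
      padicValInt p W'.minimalDiscriminantInt ≤ 4 → TypeGOrd W' p → ∀ (m : ℕ) [NeZero m], ¬ p ∣ m →
      ∀ (w : ((primesEquiv (R := 𝓞 ℚ)).symm ⟨p, hp.out⟩).Extension (𝓞 (CyclotomicField m ℚ))) (hw : ((p : ℕ) : 𝓞 (CyclotomicField m ℚ)) ∈ w.1.asIdeal)
      [CharZero (w.1.adicCompletion (CyclotomicField m ℚ))] [Fact (¬ IsUnit ((p : ℕ) : integerC (w.1.adicCompletion (CyclotomicField m ℚ))))]
      [IsAdicComplete (Ideal.span {((p : ℕ) : integerC (w.1.adicCompletion (CyclotomicField m ℚ)))}) (integerC (w.1.adicCompletion (CyclotomicField m ℚ)))]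
      (hL : valuation (w.1.adicCompletion (CyclotomicField m ℚ)) ((p : ℕ) : (w.1.adicCompletion (CyclotomicField m ℚ))) < 1), letI := LocalField.adicCompletionPadicAlgebra w.1 p hw
      letI : Algebra (Place.Completion (K := ℚ) (Sum.inr ((primesEquiv (R := 𝓞 ℚ)).symm ⟨p, hp.out⟩))) (w.1.adicCompletion (CyclotomicField m ℚ)) :=
      inferInstanceAs (Algebra (((primesEquiv (R := 𝓞 ℚ)).symm ⟨p, hp.out⟩).adicCompletion ℚ) (w.1.adicCompletion (CyclotomicField m ℚ)))
      ∀ (wv : Valuation (Place.Completion (Sum.inr ((primesEquiv (R := 𝓞 ℚ)).symm ⟨p, hp.out⟩) : Place ℚ)) ℝ≥0) [wv.Compatible]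
      [(W'.baseChange (Place.Completion (Sum.inr ((primesEquiv (R := 𝓞 ℚ)).symm ⟨p, hp.out⟩) : Place ℚ))).IsIntegral wv.integer]
      (ν : Valuation (w.1.adicCompletion (CyclotomicField m ℚ)) ℝ≥0) [ν.Compatible] [(W'.baseChange (w.1.adicCompletion (CyclotomicField m ℚ))).IsIntegral ν.integer]
      (e : (k : ℕ) → geomTorsion W' ((p ^ k : ℕ) : ℤ) → geomTorsion W' ((p ^ k : ℕ) : ℤ) → AlgebraicClosure ℚ) (hμ : ∀ k S T, e k S T ^ (p ^ k) = 1)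
      (hadd₁ : ∀ k S₁ S₂ T, e k (S₁ + S₂) T = e k S₁ T * e k S₂ T) (hadd₂ : ∀ k S T₁ T₂, e k S (T₁ + T₂) = e k S T₁ * e k S T₂)
      (hgal : ∀ k (σ : absoluteGaloisGroup ℚ) (S T : geomTorsion W' ((p ^ k : ℕ) : ℤ)), σ • e k S T = e k (σ • S) (σ • T))
      (_hnondeg : ∀ k (T : geomTorsion W' ((p ^ k : ℕ) : ℤ)), (∀ S, e k S T = 1) → T = 0) (_halt : ∀ k (S : geomTorsion W' ((p ^ k : ℕ) : ℤ)), e k S S = 1)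
      (hcompat : ∀ k (S T : geomTorsion W' ((p ^ (k + 1) : ℕ) : ℤ)),
      e k (torsionMulHom W' (p ^ (k + 1)) (p ^ k) p (pow_succ p k).symm S) (torsionMulHom W' (p ^ (k + 1)) (p ^ k) p (pow_succ p k).symm T) = e (k + 1) S T ^ p)
      (d₀ : LocalNeronLineAt W' p ((primesEquiv (R := 𝓞 ℚ)).symm ⟨p, hp.out⟩)) (d : LocalNeronLine W' hL ((galRestrictPlace ((primesEquiv (R := 𝓞 ℚ)).symm ⟨p, hp.out⟩)).comp
      (absGaloisRestrict (Place.Completion (Sum.inr ((primesEquiv (R := 𝓞 ℚ)).symm ⟨p, hp.out⟩) : Place ℚ)) (w.1.adicCompletion (CyclotomicField m ℚ))))),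
      (bdRPeriodRingData (valuation_place_lt_one p ((primesEquiv (R := 𝓞 ℚ)).symm ⟨p, hp.out⟩))).CupLogInjective (logCyclotomic p)
      (localRationalTateRep W' p (galRestrictPlace ((primesEquiv (R := 𝓞 ℚ)).symm ⟨p, hp.out⟩))) →
      (∀ z : contOneCocycles (localRationalTateRep W' p (galRestrictPlace ((primesEquiv (R := 𝓞 ℚ)).symm ⟨p, hp.out⟩))).toTopRep,
      (bdRPeriodRingData (valuation_place_lt_one p ((primesEquiv (R := 𝓞 ℚ)).symm ⟨p, hp.out⟩))).HasDualExp (logCyclotomic p)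
      (localRationalTateRep W' p (galRestrictPlace ((primesEquiv (R := 𝓞 ℚ)).symm ⟨p, hp.out⟩))) fun σ => z.1 σ) →
      (bdRPeriodRingData (F := (w.1.adicCompletion (CyclotomicField m ℚ))) (p := p) hL).CupLogInjective (logCyclotomic p) (localRationalTateRep W' p
      ((galRestrictPlace ((primesEquiv (R := 𝓞 ℚ)).symm ⟨p, hp.out⟩)).comp (absGaloisRestrict (Place.Completion (Sum.inr ((primesEquiv (R := 𝓞 ℚ)).symm ⟨p, hp.out⟩) : Place ℚ)) (w.1.adicCompletion (CyclotomicField m ℚ))))) →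
      (∀ z : contOneCocycles (localRationalTateRep W' p
      ((galRestrictPlace ((primesEquiv (R := 𝓞 ℚ)).symm ⟨p, hp.out⟩)).comp (absGaloisRestrict (Place.Completion (Sum.inr ((primesEquiv (R := 𝓞 ℚ)).symm ⟨p, hp.out⟩) : Place ℚ)) (w.1.adicCompletion (CyclotomicField m ℚ))))).toTopRep,
      (bdRPeriodRingData (F := (w.1.adicCompletion (CyclotomicField m ℚ))) (p := p) hL).HasDualExp (logCyclotomic p) (localRationalTateRep W' p
      ((galRestrictPlace ((primesEquiv (R := 𝓞 ℚ)).symm ⟨p, hp.out⟩)).comp (absGaloisRestrict (Place.Completion (Sum.inr ((primesEquiv (R := 𝓞 ℚ)).symm ⟨p, hp.out⟩) : Place ℚ)) (w.1.adicCompletion (CyclotomicField m ℚ)))))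
      fun σ => z.1 σ) → (∀ (η₀ : contOneCocycles (restrictedTateRep W' (Place.Completion (Sum.inr ((primesEquiv (R := 𝓞 ℚ)).symm ⟨p, hp.out⟩) : Place ℚ)) p).toTopRep)
      (ηT : contOneCocycles ((restrictedTateRep W' (Place.Completion (Sum.inr ((primesEquiv (R := 𝓞 ℚ)).symm ⟨p, hp.out⟩) : Place ℚ)) p).restrict
      (absGaloisRestrict (Place.Completion (Sum.inr ((primesEquiv (R := 𝓞 ℚ)).symm ⟨p, hp.out⟩) : Place ℚ)) (w.1.adicCompletion (CyclotomicField m ℚ)))).toTopRep),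
      (∀ σ, ηT.1 σ = η₀.1 (absGaloisRestrict (Place.Completion (Sum.inr ((primesEquiv (R := 𝓞 ℚ)).symm ⟨p, hp.out⟩) : Place ℚ)) (w.1.adicCompletion (CyclotomicField m ℚ)) σ)) →
      expStarCoordTower W' (F₀ := (Place.Completion (Sum.inr ((primesEquiv (R := 𝓞 ℚ)).symm ⟨p, hp.out⟩) : Place ℚ))) hL d ηT =
      algebraMap (Place.Completion (Sum.inr ((primesEquiv (R := 𝓞 ℚ)).symm ⟨p, hp.out⟩) : Place ℚ)) (w.1.adicCompletion (CyclotomicField m ℚ))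
      (expStarCoord W' (valuation_place_lt_one p ((primesEquiv (R := 𝓞 ℚ)).symm ⟨p, hp.out⟩)) d₀ η₀)) →
      ∃ c : (Place.Completion (Sum.inr ((primesEquiv (R := 𝓞 ℚ)).symm ⟨p, hp.out⟩) : Place ℚ)), c ≠ 0 ∧
      (∀ (η₀ : contOneCocycles (restrictedTateRep W' (Place.Completion (Sum.inr ((primesEquiv (R := 𝓞 ℚ)).symm ⟨p, hp.out⟩) : Place ℚ)) p).toTopRep)
      (P : (W'.baseChange (Place.Completion (Sum.inr ((primesEquiv (R := 𝓞 ℚ)).symm ⟨p, hp.out⟩) : Place ℚ))).toAffine.Point),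
      ((tatePairingPoint W' (Place.Completion (Sum.inr ((primesEquiv (R := 𝓞 ℚ)).symm ⟨p, hp.out⟩) : Place ℚ)) p e hμ hadd₁ hadd₂ hgal hcompat (oneCocycleClass _ η₀) P : ℤ_[p]) : ℚ_[p]) =
      Algebra.trace ℚ_[p] (Place.Completion (Sum.inr ((primesEquiv (R := 𝓞 ℚ)).symm ⟨p, hp.out⟩) : Place ℚ))
      (c * expStarCoord W' (valuation_place_lt_one p ((primesEquiv (R := 𝓞 ℚ)).symm ⟨p, hp.out⟩)) d₀ η₀ *
      padicLogPointFiniteExt wv (W'.baseChange (Place.Completion (Sum.inr ((primesEquiv (R := 𝓞 ℚ)).symm ⟨p, hp.out⟩) : Place ℚ))) p P)) ∧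
      (∀ (ηT : contOneCocycles ((restrictedTateRep W' (Place.Completion (Sum.inr ((primesEquiv (R := 𝓞 ℚ)).symm ⟨p, hp.out⟩) : Place ℚ)) p).restrict
      (absGaloisRestrict (Place.Completion (Sum.inr ((primesEquiv (R := 𝓞 ℚ)).symm ⟨p, hp.out⟩) : Place ℚ)) (w.1.adicCompletion (CyclotomicField m ℚ)))).toTopRep)
      (P : (W'.baseChange (w.1.adicCompletion (CyclotomicField m ℚ))).toAffine.Point),
      ((tatePairingPointTower W' (Place.Completion (Sum.inr ((primesEquiv (R := 𝓞 ℚ)).symm ⟨p, hp.out⟩) : Place ℚ)) e hμ hadd₁ hadd₂ hgal hcompat (oneCocycleClass _ ηT) P : ℤ_[p]) : ℚ_[p]) =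
      Algebra.trace ℚ_[p] (w.1.adicCompletion (CyclotomicField m ℚ))
      (algebraMap (Place.Completion (Sum.inr ((primesEquiv (R := 𝓞 ℚ)).symm ⟨p, hp.out⟩) : Place ℚ)) (w.1.adicCompletion (CyclotomicField m ℚ)) c * expStarCoordTower W' (F₀ := (Place.Completion (Sum.inr ((primesEquiv (R := 𝓞 ℚ)).symm ⟨p, hp.out⟩) : Place ℚ))) hL d ηT *
      padicLogPointFiniteExt ν (W'.baseChange (w.1.adicCompletion (CyclotomicField m ℚ))) p P)) := by
  intro W' _ _ p hp hp5 hadd h4 hG m _ _hm w hw _ _ _ hL wv _ _ ν _ _ e hμ hadd₁ hadd₂ hgal hnondeg halt hcompat d₀ d _hcli₀ _hde₀ hcli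
    hde hcomp
  -- the ramification index `e = 12/gcd(12, ord_p Δ_min)` (Tate's table: II ↦ 6, III ↦ 4, IV ↦ 3)
  obtain ⟨e', he', htab⟩ : ∃ e' : ℕ, 0 < e' ∧ (padicValInt p W'.minimalDiscriminantInt = 2 ∧ e' = 6 ∨
      padicValInt p W'.minimalDiscriminantInt = 3 ∧ e' = 4 ∨ padicValInt p W'.minimalDiscriminantInt = 4 ∧ e' = 3) := by
    rcases TeichmullerTwistDescent.TameExponent.padicValInt_mem W' p hp5 hadd h4 with h2 | h3 | h4'
    · exact ⟨6, by norm_num, Or.inl ⟨h2, rfl⟩⟩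
    · exact ⟨4, by norm_num, Or.inr (Or.inl ⟨h3, rfl⟩)⟩
    · exact ⟨3, by norm_num, Or.inr (Or.inr ⟨h4', rfl⟩)⟩
  -- K-DATA: `K = ℚ(ζ_m, p^{1/e})`, a place `w′ ∣ w`, the packet keys of `K_{w′}`, the compatible norm valuation
  obtain ⟨K, _, _, _, _, α, hα, hpl⟩ := StarredOptimalManinUnitFiveSevenRecTowerKData.exists_numberField_over_cyclotomic_pow_eq_prime m he' p
  obtain ⟨w', hw'⟩ := hpl w.1 hw
  haveI : CharZero (w'.1.adicCompletion K) := LocalField.charZero_adicCompletion w'.1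
  have hp' : valuation (w'.1.adicCompletion K) ((p : ℕ) : w'.1.adicCompletion K) < 1 := LocalField.valuation_adicCompletion_natCast_lt_one w'.1 p hw'
  haveI : Fact (¬ IsUnit ((p : ℕ) : integerC (w'.1.adicCompletion K))) := ⟨not_isUnit_natCast_integerC hp'⟩
  haveI : IsAdicComplete (Ideal.span {((p : ℕ) : integerC (w'.1.adicCompletion K))}) (integerC (w'.1.adicCompletion K)) :=
    isAdicComplete_integerC_natCast hp'
  haveI := compatible_normValuation_adicCompletion (K := K) w'.1
  haveI : (W'.baseChange (w'.1.adicCompletion K)).IsIntegral (NormedField.valuation : Valuation (w'.1.adicCompletion K) ℝ≥0).integer :=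
    KPort.Kw.isIntegral_baseChange_of_isGloballyMinimal _ W'
  letI := LocalField.adicCompletionPadicAlgebra w.1 p hw
  letI : Algebra (Place.Completion (K := ℚ) (Sum.inr ((primesEquiv (R := 𝓞 ℚ)).symm ⟨p, hp.out⟩))) (w.1.adicCompletion (CyclotomicField m ℚ)) :=
    inferInstanceAs (Algebra (((primesEquiv (R := 𝓞 ℚ)).symm ⟨p, hp.out⟩).adicCompletion ℚ) (w.1.adicCompletion (CyclotomicField m ℚ)))
  letI := LocalField.adicCompletionPadicAlgebra w'.1 p hw'
  -- the Prop-1.2.3 binders of the direct representation over `K_{w′}`: de Rham ascent `ℚ_v → L_w → K_{w′}` + Kato II Prop. 1.2.3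
  haveI : Module.Finite ℚ_[p] (W'.rationalTateModule p) := module_finite_rationalTateModule_holds W' p
  have hDRK : GaloisRep.IsDeRham (bdRPeriodRingData (F := w'.1.adicCompletion K) (p := p) hp')
      (restrictedRationalTateRep W' (w'.1.adicCompletion K) p) :=
    isDeRham_restrictedRationalTateRep_adicCompletion_of_typeGOrd W' p hG w'.1 hw' hp'
  obtain ⟨hinjK, hdeK⟩ := cupLogInjective_and_hasDualExp_of_isDeRham_holds hp' (restrictedRationalTateRep W' (w'.1.adicCompletion K) p) hDRK
  exact recTowerAt_cyclotomic_of_formula_over_completion W' p (isDeRham_place_of_typeGOrd W' p hG) m w hw hL wv ν w' hw' hp'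
    (NormedField.valuation : Valuation (w'.1.adicCompletion K) ℝ≥0) e hμ hadd₁ hadd₂ hgal hcompat hnondeg hcli hde d₀ d hcomp
    (localFormulaOrdinaryUnstarred_of_typeGOrd W' p hp5 hadd h4 hG α e' htab hα w'.1 hw' hp' NormedField.valuation e hμ hadd₁ hadd₂ hgal
      hnondeg halt hcompat hinjK hdeK)

/-- ★★★ **[REC-tower] at every cyclotomic tower for the (G)-ORDINARY STARRED potentially good curves (`ord_p Δ_min ∈ {8, 9, 10}`), EVERY prime `p ≥ 5` — PROVED.**
For every globally minimal `W′/ℚ` with `p ≥ 5`, additive reduction at `p`, `ord_p Δ_min ∈ {8, 9, 10}` (IV*, III*, II*; `I₀*` is NOT covered), `TypeGOrd W′ p`, every `m` with `p ∤ m`, every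
place `w ∣ p` of `ℚ(ζ_m)` (keys quantified), every pair of compatible valuations, every ALTERNATING Weil tower, line data `d₀` at `ℚ_v` and `d` at `ℚ(ζ_m)_w` with the
compatibility `hcomp`, and the Prop-1.2.3 binders: **`∃ c ≠ 0` with `⟨[η₀], P⟩ = Tr(c·exp*_{d₀}(η₀)·log P)` at `ℚ_v` and `⟨[η], P⟩ = Tr(c·exp*_d(η)·log P)` at `ℚ(ζ_m)_w`.**
Proof: the generic turnkey `recTowerAt_cyclotomic_of_formula_over_completion` (`hDRv := isDeRham_place_of_typeGOrd`) over `K = ℚ(ζ_m, p^{1/e})` at a place `w′ ∣ w`, fed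
with Kato's local formula `localFormulaOrdinaryStarred_of_typeGOrd` (`e = 12/gcd(12, ord_p Δ_min) ∈ {3, 4, 6}`).
[cite: Kato1993LNM1553, Ch. II §1.2.4, Prop. 1.2.3 and Thm. 1.4.1 (3)–(4)] [cite: BrinonConrad2009, Prop. 6.3.8] [cite: Serre1972, §5.6]
[cite: SilvermanATAEC1994, IV Table 4.1] -/
theorem recTowerOrdinaryStarred_of_typeGOrd :
    ∀ (W' : WeierstrassCurve ℚ) [W'.IsElliptic] [W'.IsGloballyMinimal] (p : ℕ) [hp : Fact p.Prime], 5 ≤ p → Addv W' p →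
      (padicValInt p W'.minimalDiscriminantInt = 8 ∨ padicValInt p W'.minimalDiscriminantInt = 9 ∨ padicValInt p W'.minimalDiscriminantInt = 10) →
      TypeGOrd W' p → ∀ (m : ℕ) [NeZero m], ¬ p ∣ m →
      ∀ (w : ((primesEquiv (R := 𝓞 ℚ)).symm ⟨p, hp.out⟩).Extension (𝓞 (CyclotomicField m ℚ))) (hw : ((p : ℕ) : 𝓞 (CyclotomicField m ℚ)) ∈ w.1.asIdeal)
      [CharZero (w.1.adicCompletion (CyclotomicField m ℚ))] [Fact (¬ IsUnit ((p : ℕ) : integerC (w.1.adicCompletion (CyclotomicField m ℚ))))]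
      [IsAdicComplete (Ideal.span {((p : ℕ) : integerC (w.1.adicCompletion (CyclotomicField m ℚ)))}) (integerC (w.1.adicCompletion (CyclotomicField m ℚ)))]
      (hL : valuation (w.1.adicCompletion (CyclotomicField m ℚ)) ((p : ℕ) : (w.1.adicCompletion (CyclotomicField m ℚ))) < 1), letI := LocalField.adicCompletionPadicAlgebra w.1 p hw
      letI : Algebra (Place.Completion (K := ℚ) (Sum.inr ((primesEquiv (R := 𝓞 ℚ)).symm ⟨p, hp.out⟩))) (w.1.adicCompletion (CyclotomicField m ℚ)) :=
      inferInstanceAs (Algebra (((primesEquiv (R := 𝓞 ℚ)).symm ⟨p, hp.out⟩).adicCompletion ℚ) (w.1.adicCompletion (CyclotomicField m ℚ)))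
      ∀ (wv : Valuation (Place.Completion (Sum.inr ((primesEquiv (R := 𝓞 ℚ)).symm ⟨p, hp.out⟩) : Place ℚ)) ℝ≥0) [wv.Compatible]
      [(W'.baseChange (Place.Completion (Sum.inr ((primesEquiv (R := 𝓞 ℚ)).symm ⟨p, hp.out⟩) : Place ℚ))).IsIntegral wv.integer]
      (ν : Valuation (w.1.adicCompletion (CyclotomicField m ℚ)) ℝ≥0) [ν.Compatible] [(W'.baseChange (w.1.adicCompletion (CyclotomicField m ℚ))).IsIntegral ν.integer]
      (e : (k : ℕ) → geomTorsion W' ((p ^ k : ℕ) : ℤ) → geomTorsion W' ((p ^ k : ℕ) : ℤ) → AlgebraicClosure ℚ) (hμ : ∀ k S T, e k S T ^ (p ^ k) = 1)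
      (hadd₁ : ∀ k S₁ S₂ T, e k (S₁ + S₂) T = e k S₁ T * e k S₂ T) (hadd₂ : ∀ k S T₁ T₂, e k S (T₁ + T₂) = e k S T₁ * e k S T₂)
      (hgal : ∀ k (σ : absoluteGaloisGroup ℚ) (S T : geomTorsion W' ((p ^ k : ℕ) : ℤ)), σ • e k S T = e k (σ • S) (σ • T))
      (_hnondeg : ∀ k (T : geomTorsion W' ((p ^ k : ℕ) : ℤ)), (∀ S, e k S T = 1) → T = 0) (_halt : ∀ k (S : geomTorsion W' ((p ^ k : ℕ) : ℤ)), e k S S = 1)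
      (hcompat : ∀ k (S T : geomTorsion W' ((p ^ (k + 1) : ℕ) : ℤ)),
      e k (torsionMulHom W' (p ^ (k + 1)) (p ^ k) p (pow_succ p k).symm S) (torsionMulHom W' (p ^ (k + 1)) (p ^ k) p (pow_succ p k).symm T) = e (k + 1) S T ^ p)
      (d₀ : LocalNeronLineAt W' p ((primesEquiv (R := 𝓞 ℚ)).symm ⟨p, hp.out⟩)) (d : LocalNeronLine W' hL ((galRestrictPlace ((primesEquiv (R := 𝓞 ℚ)).symm ⟨p, hp.out⟩)).comp
      (absGaloisRestrict (Place.Completion (Sum.inr ((primesEquiv (R := 𝓞 ℚ)).symm ⟨p, hp.out⟩) : Place ℚ)) (w.1.adicCompletion (CyclotomicField m ℚ))))),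
      (bdRPeriodRingData (valuation_place_lt_one p ((primesEquiv (R := 𝓞 ℚ)).symm ⟨p, hp.out⟩))).CupLogInjective (logCyclotomic p)
      (localRationalTateRep W' p (galRestrictPlace ((primesEquiv (R := 𝓞 ℚ)).symm ⟨p, hp.out⟩))) →
      (∀ z : contOneCocycles (localRationalTateRep W' p (galRestrictPlace ((primesEquiv (R := 𝓞 ℚ)).symm ⟨p, hp.out⟩))).toTopRep,
      (bdRPeriodRingData (valuation_place_lt_one p ((primesEquiv (R := 𝓞 ℚ)).symm ⟨p, hp.out⟩))).HasDualExp (logCyclotomic p)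
      (localRationalTateRep W' p (galRestrictPlace ((primesEquiv (R := 𝓞 ℚ)).symm ⟨p, hp.out⟩))) fun σ => z.1 σ) →
      (bdRPeriodRingData (F := (w.1.adicCompletion (CyclotomicField m ℚ))) (p := p) hL).CupLogInjective (logCyclotomic p) (localRationalTateRep W' p
      ((galRestrictPlace ((primesEquiv (R := 𝓞 ℚ)).symm ⟨p, hp.out⟩)).comp (absGaloisRestrict (Place.Completion (Sum.inr ((primesEquiv (R := 𝓞 ℚ)).symm ⟨p, hp.out⟩) : Place ℚ)) (w.1.adicCompletion (CyclotomicField m ℚ))))) →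
      (∀ z : contOneCocycles (localRationalTateRep W' p
      ((galRestrictPlace ((primesEquiv (R := 𝓞 ℚ)).symm ⟨p, hp.out⟩)).comp (absGaloisRestrict (Place.Completion (Sum.inr ((primesEquiv (R := 𝓞 ℚ)).symm ⟨p, hp.out⟩) : Place ℚ)) (w.1.adicCompletion (CyclotomicField m ℚ))))).toTopRep,
      (bdRPeriodRingData (F := (w.1.adicCompletion (CyclotomicField m ℚ))) (p := p) hL).HasDualExp (logCyclotomic p) (localRationalTateRep W' p
      ((galRestrictPlace ((primesEquiv (R := 𝓞 ℚ)).symm ⟨p, hp.out⟩)).comp (absGaloisRestrict (Place.Completion (Sum.inr ((primesEquiv (R := 𝓞 ℚ)).symm ⟨p, hp.out⟩) : Place ℚ)) (w.1.adicCompletion (CyclotomicField m ℚ)))))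
      fun σ => z.1 σ) → (∀ (η₀ : contOneCocycles (restrictedTateRep W' (Place.Completion (Sum.inr ((primesEquiv (R := 𝓞 ℚ)).symm ⟨p, hp.out⟩) : Place ℚ)) p).toTopRep)
      (ηT : contOneCocycles ((restrictedTateRep W' (Place.Completion (Sum.inr ((primesEquiv (R := 𝓞 ℚ)).symm ⟨p, hp.out⟩) : Place ℚ)) p).restrict
      (absGaloisRestrict (Place.Completion (Sum.inr ((primesEquiv (R := 𝓞 ℚ)).symm ⟨p, hp.out⟩) : Place ℚ)) (w.1.adicCompletion (CyclotomicField m ℚ)))).toTopRep),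
      (∀ σ, ηT.1 σ = η₀.1 (absGaloisRestrict (Place.Completion (Sum.inr ((primesEquiv (R := 𝓞 ℚ)).symm ⟨p, hp.out⟩) : Place ℚ)) (w.1.adicCompletion (CyclotomicField m ℚ)) σ)) →
      expStarCoordTower W' (F₀ := (Place.Completion (Sum.inr ((primesEquiv (R := 𝓞 ℚ)).symm ⟨p, hp.out⟩) : Place ℚ))) hL d ηT =
      algebraMap (Place.Completion (Sum.inr ((primesEquiv (R := 𝓞 ℚ)).symm ⟨p, hp.out⟩) : Place ℚ)) (w.1.adicCompletion (CyclotomicField m ℚ))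
      (expStarCoord W' (valuation_place_lt_one p ((primesEquiv (R := 𝓞 ℚ)).symm ⟨p, hp.out⟩)) d₀ η₀)) →
      ∃ c : (Place.Completion (Sum.inr ((primesEquiv (R := 𝓞 ℚ)).symm ⟨p, hp.out⟩) : Place ℚ)), c ≠ 0 ∧
      (∀ (η₀ : contOneCocycles (restrictedTateRep W' (Place.Completion (Sum.inr ((primesEquiv (R := 𝓞 ℚ)).symm ⟨p, hp.out⟩) : Place ℚ)) p).toTopRep)
      (P : (W'.baseChange (Place.Completion (Sum.inr ((primesEquiv (R := 𝓞 ℚ)).symm ⟨p, hp.out⟩) : Place ℚ))).toAffine.Point),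
      ((tatePairingPoint W' (Place.Completion (Sum.inr ((primesEquiv (R := 𝓞 ℚ)).symm ⟨p, hp.out⟩) : Place ℚ)) p e hμ hadd₁ hadd₂ hgal hcompat (oneCocycleClass _ η₀) P : ℤ_[p]) : ℚ_[p]) =
      Algebra.trace ℚ_[p] (Place.Completion (Sum.inr ((primesEquiv (R := 𝓞 ℚ)).symm ⟨p, hp.out⟩) : Place ℚ))
      (c * expStarCoord W' (valuation_place_lt_one p ((primesEquiv (R := 𝓞 ℚ)).symm ⟨p, hp.out⟩)) d₀ η₀ *
      padicLogPointFiniteExt wv (W'.baseChange (Place.Completion (Sum.inr ((primesEquiv (R := 𝓞 ℚ)).symm ⟨p, hp.out⟩) : Place ℚ))) p P)) ∧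
      (∀ (ηT : contOneCocycles ((restrictedTateRep W' (Place.Completion (Sum.inr ((primesEquiv (R := 𝓞 ℚ)).symm ⟨p, hp.out⟩) : Place ℚ)) p).restrict
      (absGaloisRestrict (Place.Completion (Sum.inr ((primesEquiv (R := 𝓞 ℚ)).symm ⟨p, hp.out⟩) : Place ℚ)) (w.1.adicCompletion (CyclotomicField m ℚ)))).toTopRep)
      (P : (W'.baseChange (w.1.adicCompletion (CyclotomicField m ℚ))).toAffine.Point),
      ((tatePairingPointTower W' (Place.Completion (Sum.inr ((primesEquiv (R := 𝓞 ℚ)).symm ⟨p, hp.out⟩) : Place ℚ)) e hμ hadd₁ hadd₂ hgal hcompat (oneCocycleClass _ ηT) P : ℤ_[p]) : ℚ_[p]) =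
      Algebra.trace ℚ_[p] (w.1.adicCompletion (CyclotomicField m ℚ))
      (algebraMap (Place.Completion (Sum.inr ((primesEquiv (R := 𝓞 ℚ)).symm ⟨p, hp.out⟩) : Place ℚ)) (w.1.adicCompletion (CyclotomicField m ℚ)) c * expStarCoordTower W' (F₀ := (Place.Completion (Sum.inr ((primesEquiv (R := 𝓞 ℚ)).symm ⟨p, hp.out⟩) : Place ℚ))) hL d ηT *
      padicLogPointFiniteExt ν (W'.baseChange (w.1.adicCompletion (CyclotomicField m ℚ))) p P)) := by
  intro W' _ _ p hp hp5 hadd h4 hG m _ _hm w hw _ _ _ hL wv _ _ ν _ _ e hμ hadd₁ hadd₂ hgal hnondeg halt hcompat d₀ d _hcli₀ _hde₀ hcli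
    hde hcomp
  -- the ramification index `e = 12/gcd(12, ord_p Δ_min)` (Tate's table: IV* ↦ 3, III* ↦ 4, II* ↦ 6)
  obtain ⟨e', he', htab⟩ : ∃ e' : ℕ, 0 < e' ∧ (padicValInt p W'.minimalDiscriminantInt = 8 ∧ e' = 3 ∨
      padicValInt p W'.minimalDiscriminantInt = 9 ∧ e' = 4 ∨ padicValInt p W'.minimalDiscriminantInt = 10 ∧ e' = 6) := by
    rcases h4 with h8 | h9 | h10
    · exact ⟨3, by norm_num, Or.inl ⟨h8, rfl⟩⟩
    · exact ⟨4, by norm_num, Or.inr (Or.inl ⟨h9, rfl⟩)⟩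
    · exact ⟨6, by norm_num, Or.inr (Or.inr ⟨h10, rfl⟩)⟩
  -- K-DATA: `K = ℚ(ζ_m, p^{1/e})`, a place `w′ ∣ w`, the packet keys of `K_{w′}`, the compatible norm valuation
  obtain ⟨K, _, _, _, _, α, hα, hpl⟩ := StarredOptimalManinUnitFiveSevenRecTowerKData.exists_numberField_over_cyclotomic_pow_eq_prime m he' p
  obtain ⟨w', hw'⟩ := hpl w.1 hw
  haveI : CharZero (w'.1.adicCompletion K) := LocalField.charZero_adicCompletion w'.1
  have hp' : valuation (w'.1.adicCompletion K) ((p : ℕ) : w'.1.adicCompletion K) < 1 := LocalField.valuation_adicCompletion_natCast_lt_one w'.1 p hw'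
  haveI : Fact (¬ IsUnit ((p : ℕ) : integerC (w'.1.adicCompletion K))) := ⟨not_isUnit_natCast_integerC hp'⟩
  haveI : IsAdicComplete (Ideal.span {((p : ℕ) : integerC (w'.1.adicCompletion K))}) (integerC (w'.1.adicCompletion K)) :=
    isAdicComplete_integerC_natCast hp'
  haveI := compatible_normValuation_adicCompletion (K := K) w'.1
  haveI : (W'.baseChange (w'.1.adicCompletion K)).IsIntegral (NormedField.valuation : Valuation (w'.1.adicCompletion K) ℝ≥0).integer :=
    KPort.Kw.isIntegral_baseChange_of_isGloballyMinimal _ W'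
  letI := LocalField.adicCompletionPadicAlgebra w.1 p hw
  letI : Algebra (Place.Completion (K := ℚ) (Sum.inr ((primesEquiv (R := 𝓞 ℚ)).symm ⟨p, hp.out⟩))) (w.1.adicCompletion (CyclotomicField m ℚ)) :=
    inferInstanceAs (Algebra (((primesEquiv (R := 𝓞 ℚ)).symm ⟨p, hp.out⟩).adicCompletion ℚ) (w.1.adicCompletion (CyclotomicField m ℚ)))
  letI := LocalField.adicCompletionPadicAlgebra w'.1 p hw'
  -- the Prop-1.2.3 binders of the direct representation over `K_{w′}`: de Rham ascent `ℚ_v → L_w → K_{w′}` + Kato II Prop. 1.2.3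
  haveI : Module.Finite ℚ_[p] (W'.rationalTateModule p) := module_finite_rationalTateModule_holds W' p
  have hDRK : GaloisRep.IsDeRham (bdRPeriodRingData (F := w'.1.adicCompletion K) (p := p) hp')
      (restrictedRationalTateRep W' (w'.1.adicCompletion K) p) :=
    isDeRham_restrictedRationalTateRep_adicCompletion_of_typeGOrd W' p hG w'.1 hw' hp'
  obtain ⟨hinjK, hdeK⟩ := cupLogInjective_and_hasDualExp_of_isDeRham_holds hp' (restrictedRationalTateRep W' (w'.1.adicCompletion K) p) hDRK
  exact recTowerAt_cyclotomic_of_formula_over_completion W' p (isDeRham_place_of_typeGOrd W' p hG) m w hw hL wv ν w' hw' hp'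
    (NormedField.valuation : Valuation (w'.1.adicCompletion K) ℝ≥0) e hμ hadd₁ hadd₂ hgal hcompat hnondeg hcli hde d₀ d hcomp
    (localFormulaOrdinaryStarred_of_typeGOrd W' p hp5 hadd hG α e' htab hα w'.1 hw' hp' NormedField.valuation e hμ hadd₁ hadd₂ hgal
      hnondeg halt hcompat hinjK hdeK)

end Summit.BirchSwinnertonDyer.BirchSwinnertonDyer.Theorems.RecTowerOrdinaryUnstarredAnyPrime

end
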